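import Summits.MatrixMultiplication.OmegaCensus.Cyclo7Data

/-!
# ω-census, family (b3): conjecture C9 — `(ℤ[ζ₇]/p) ⋊ C₇`: exact-count CERTIFICATES, part 2 (primes `71 ≤ p ≤ 137`)

HONEST FRAMING (pub-omega census; verbatim): lottery ticket; floor = certified bounds/negative ranges.
Census BOOKKEEPING (conjecture C9 of the cell; pub-omega stpp-1 gen 22).  ONE datum for all primes: box `α = (1 + ζ)/2`,
`β = −ζ(1 + ζ)/2`, `t = 3` (`A = (1,1,0,0,0,0)`, `B = (0,−1,−1,0,0,0)` w.r.t. `1, ζ, …, ζ⁵`), a pattern of `144` of the `9·64`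
(column, phase-vector) half blocks and constant trims (total `258`, each coordinate `lo + hi ≤ 2`; exact errors `|E| ≤ 2`) — seat search
HOME/pub-omega-stpp-1-g22/code/inert7data.py, validated by literal `𝔽_p[X]/(Φ₇)` arithmetic (`0` conflicts among the `3 368 856` cells at
`p = 11`).  `zd7_ok`: the `p`-independent check (`decide`).  **`Z7Cyc.not_boxUseful_ge`**: every prime `p ≥ 139` (uniform count
`576 p⁶ ≤ 720 (p − 5)⁶`); **`zeta7_q`** for the 29 primes `11 ≤ q < 139` (exact count by `decide`); **`Z7Cyc.not_boxUseful`: for every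
prime `p ≥ 11`, `(ℤ[ζ₇]/p) ⋊ ℤ/7` (order `7p⁶`) is not box-useful** — box ratio `≥ 9/5`.  For `p ≡ 3, 5 (mod 7)` (`ord₇ p = 6`:
`p = 17, 19, 31, 47, 59, 61, …`) these are the Schmidt atoms `A(p,7) = 𝔽_{p⁶} ⋊ C₇`.  Left open here: `p = 3, 5` (`𝔽_{3⁶} ⋊ C₇`,
`𝔽_{5⁶} ⋊ C₇`: the `p = 5` count of this datum is `24177 < 28125`).  Nothing here is progress on `ω`.
-/

namespace Summit.MatrixMultiplication.OmegaCensus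

namespace Z7Cyc

open Cyclo7

/-- `1 < 71`. [folklore] -/
instance fact_one_lt_71 : Fact (1 < 71) := ⟨by norm_num⟩

/-- `(ℤ[ζ₇]/71) ⋊ C₇` (order `896701987447`) is not box-useful (exact count `280868334636 ≥ 230580511058`). [folklore] -/
theorem zeta7_71 : ¬ BoxUseful (Z7Cyc 71) :=
  haveI : Fact (Nat.Prime 71) := ⟨by norm_num⟩
  not_boxUseful_of_count7 (by norm_num) zd7 zd7_ok (by norm_num) (by decide +kernel)

/-- `1 < 73`. [folklore] -/
instance fact_one_lt_73 : Fact (1 < 73) := ⟨by norm_num⟩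

/-- `(ℤ[ζ₇]/73) ⋊ C₇` (order `1059339584023`) is not box-useful (exact count `332045756137 ≥ 272401607321`). [folklore] -/
theorem zeta7_73 : ¬ BoxUseful (Z7Cyc 73) :=
  haveI : Fact (Nat.Prime 73) := ⟨by norm_num⟩
  not_boxUseful_of_count7 (by norm_num) zd7 zd7_ok (by norm_num) (by decide +kernel)

/-- `1 < 79`. [folklore] -/
instance fact_one_lt_79 : Fact (1 < 79) := ⟨by norm_num⟩

/-- `(ℤ[ζ₇]/79) ⋊ C₇` (order `1701612188647`) is not box-useful (exact count `534384515692 ≥ 437557419938`). [folklore] -/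
theorem zeta7_79 : ¬ BoxUseful (Z7Cyc 79) :=
  haveI : Fact (Nat.Prime 79) := ⟨by norm_num⟩
  not_boxUseful_of_count7 (by norm_num) zd7 zd7_ok (by norm_num) (by decide +kernel)

/-- `1 < 83`. [folklore] -/
instance fact_one_lt_83 : Fact (1 < 83) := ⟨by norm_num⟩

/-- `(ℤ[ζ₇]/83) ⋊ C₇` (order `2288582613583`) is not box-useful (exact count `719526473832 ≥ 588492672065`). [folklore] -/
theorem zeta7_83 : ¬ BoxUseful (Z7Cyc 83) :=
  haveI : Fact (Nat.Prime 83) := ⟨by norm_num⟩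
  not_boxUseful_of_count7 (by norm_num) zd7 zd7_ok (by norm_num) (by decide +kernel)

/-- `1 < 89`. [folklore] -/
instance fact_one_lt_89 : Fact (1 < 89) := ⟨by norm_num⟩

/-- `(ℤ[ζ₇]/89) ⋊ C₇` (order `3478869036727`) is not box-useful (exact count `1095384186777 ≥ 894566323730`). [folklore] -/
theorem zeta7_89 : ¬ BoxUseful (Z7Cyc 89) :=
  haveI : Fact (Nat.Prime 89) := ⟨by norm_num⟩
  not_boxUseful_of_count7 (by norm_num) zd7 zd7_ok (by norm_num) (by decide +kernel)

/-- `1 < 97`. [folklore] -/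
instance fact_one_lt_97 : Fact (1 < 97) := ⟨by norm_num⟩

/-- `(ℤ[ζ₇]/97) ⋊ C₇` (order `5830804034503`) is not box-useful (exact count `1839061428769 ≥ 1499349608873`). [folklore] -/
theorem zeta7_97 : ¬ BoxUseful (Z7Cyc 97) :=
  haveI : Fact (Nat.Prime 97) := ⟨by norm_num⟩
  not_boxUseful_of_count7 (by norm_num) zd7 zd7_ok (by norm_num) (by decide +kernel)

/-- `1 < 101`. [folklore] -/
instance fact_one_lt_101 : Fact (1 < 101) := ⟨by norm_num⟩

/-- `(ℤ[ζ₇]/101) ⋊ C₇` (order `7430641054207`) is not box-useful (exact count `2345415582801 ≥ 1910736271082`). [folklore] -/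
theorem zeta7_101 : ¬ BoxUseful (Z7Cyc 101) :=
  haveI : Fact (Nat.Prime 101) := ⟨by norm_num⟩
  not_boxUseful_of_count7 (by norm_num) zd7 zd7_ok (by norm_num) (by decide +kernel)

/-- `1 < 103`. [folklore] -/
instance fact_one_lt_103 : Fact (1 < 103) := ⟨by norm_num⟩

/-- `(ℤ[ζ₇]/103) ⋊ C₇` (order `8358366075703`) is not box-useful (exact count `2639175566572 ≥ 2149294133753`). [folklore] -/
theorem zeta7_103 : ¬ BoxUseful (Z7Cyc 103) :=
  haveI : Fact (Nat.Prime 103) := ⟨by norm_num⟩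
  not_boxUseful_of_count7 (by norm_num) zd7 zd7_ok (by norm_num) (by decide +kernel)

/-- `1 < 107`. [folklore] -/
instance fact_one_lt_107 : Fact (1 < 107) := ⟨by norm_num⟩

/-- `(ℤ[ζ₇]/107) ⋊ C₇` (order `10505112462943`) is not box-useful (exact count `3319228291224 ≥ 2701314633329`). [folklore] -/
theorem zeta7_107 : ¬ BoxUseful (Z7Cyc 107) :=
  haveI : Fact (Nat.Prime 107) := ⟨by norm_num⟩
  not_boxUseful_of_count7 (by norm_num) zd7 zd7_ok (by norm_num) (by decide +kernel)

/-- `1 < 109`. [folklore] -/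
instance fact_one_lt_109 : Fact (1 < 109) := ⟨by norm_num⟩

/-- `(ℤ[ζ₇]/109) ⋊ C₇` (order `11739700775887`) is not box-useful (exact count `3710481162697 ≥ 3018780199514`). [folklore] -/
theorem zeta7_109 : ¬ BoxUseful (Z7Cyc 109) :=
  haveI : Fact (Nat.Prime 109) := ⟨by norm_num⟩
  not_boxUseful_of_count7 (by norm_num) zd7 zd7_ok (by norm_num) (by decide +kernel)

/-- `1 < 113`. [folklore] -/
instance fact_one_lt_113 : Fact (1 < 113) := ⟨by norm_num⟩

/-- `(ℤ[ζ₇]/113) ⋊ C₇` (order `14573662268263`) is not box-useful (exact count `4608938761617 ≥ 3747513154697`). [folklore] -/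
theorem zeta7_113 : ¬ BoxUseful (Z7Cyc 113) :=
  haveI : Fact (Nat.Prime 113) := ⟨by norm_num⟩
  not_boxUseful_of_count7 (by norm_num) zd7 zd7_ok (by norm_num) (by decide +kernel)

/-- `1 < 127`. [folklore] -/
instance fact_one_lt_127 : Fact (1 < 127) := ⟨by norm_num⟩

/-- `(ℤ[ζ₇]/127) ⋊ C₇` (order `29371110402823`) is not box-useful (exact count `9305305199884 ≥ 7552571246441`). [folklore] -/
theorem zeta7_127 : ¬ BoxUseful (Z7Cyc 127) :=
  haveI : Fact (Nat.Prime 127) := ⟨by norm_num⟩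
  not_boxUseful_of_count7 (by norm_num) zd7 zd7_ok (by norm_num) (by decide +kernel)

/-- `1 < 131`. [folklore] -/
instance fact_one_lt_131 : Fact (1 < 131) := ⟨by norm_num⟩

/-- `(ℤ[ζ₇]/131) ⋊ C₇` (order `35377392009967`) is not box-useful (exact count `11213154195816 ≥ 9097043659706`). [folklore] -/
theorem zeta7_131 : ¬ BoxUseful (Z7Cyc 131) :=
  haveI : Fact (Nat.Prime 131) := ⟨by norm_num⟩
  not_boxUseful_of_count7 (by norm_num) zd7 zd7_ok (by norm_num) (by decide +kernel)

/-- `1 < 137`. [folklore] -/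
instance fact_one_lt_137 : Fact (1 < 137) := ⟨by norm_num⟩

/-- `(ℤ[ζ₇]/137) ⋊ C₇` (order `46282993754263`) is not box-useful (exact count `14678781394089 ≥ 11901341251097`). [folklore] -/
theorem zeta7_137 : ¬ BoxUseful (Z7Cyc 137) :=
  haveI : Fact (Nat.Prime 137) := ⟨by norm_num⟩
  not_boxUseful_of_count7 (by norm_num) zd7 zd7_ok (by norm_num) (by decide +kernel)

end Z7Cyc

end Summit.MatrixMultiplication.OmegaCensus
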